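import Summits.ValiantsHypothesis.ValiantsHypothesis.Theorems.LacunarySymmetroidMatrixDescartesCensusWindowN

/-!
# `MatrixDescartes` census — FLANK ROWS at a sign repetition, DISTINCT-root currency (fileable twin)

HONEST FRAMING.  Object-search cell `pub-symmetroid`, route crux `Theses.LacunarySymmetroid.MatrixDescartes`
(ledger item stmt-ValiantsHypothesis-18050).  The FLANK ROW LEMMA of `…CensusFlankRow.lean` (engine-6 g17; reader PASS
referee g42, R1069 — «three seats») stated with the hypothesis `n − 3 ≤ #Z₊^{distinct}(f)` (the tree's census currency
`(f.roots.toFinset.filter (0<·)).card`) instead of `#Z₊^{mult}`; since `#Z₊^{distinct} ≤ #Z₊^{mult}` this twin is IMPLIED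
by the multiplicity form, but it needs only the tree's twisted Rolle (`card_posRoots_le_card_posRoots_twist_succ`) and
`twist_rsum`, both long built — it is the form the census objects meet directly (a hypothetical (2,6) nineteen: 19 ≥ 21 − 3;
every 21-term (2,6) eighteen: 18 ≥ 18; every (3,4) eighteen).  STATEMENT: `f = Σ_{t<n} c_t X^{e_t}` (`e` strictly
increasing), four consecutive coefficients `(−,+,−,−)` up to sign (`c_i c_{i+1} < 0`, `c_{i+1} c_{i+2} < 0`, `c_{i+2} c_{i+3} > 0`)
⇒ with `w_t = ∏_{u ∉ {i..i+3}} |e_t − e_u|`, `a = e_{i+1} − e_i`, `b = e_{i+2} − e_{i+1}`: BALANCE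
`|c_{i+1}| w_{i+1} x^{e_{i+1}} = Σ_{t ∈ {i,i+2,i+3}} |c_t| w_t x^{e_t}` at some `x > 0`, and the ROW
`(a+b)^{a+b} (|c_i| w_i)^b (|c_{i+2}| w_{i+2})^a ≤ (|c_{i+1}| w_{i+1})^{a+b} a^a b^b` (N″'s row with every weight divided by
`|e_t − e_{i+3}|`); mirror pattern `(+,+,−,+)`.  Located exact check 2 694/2 694 census rows (flank_check.py; referee recount
EQUAL).  NECESSARY conditions only; no bound on `ζ_sym`, nothing on `DoorA26`/`DoorA34` (OPEN), the crux, or `VP ≠ VNP`.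

[folklore] Rolle (twisted) + weighted AM–GM; the flank-row observation is the cell's (engine-6 g17). -/

-- `Summit.ValiantsHypothesis.ValiantsHypothesis.…` repeats a component by the D-0017 layout
-- (single-conjunct summit), which the `dupNamespace` linter flags; the name is mandated.
set_option linter.dupNamespace false

namespace Summit.ValiantsHypothesis.ValiantsHypothesis.Theorems.LacunarySymmetroidMatrixDescartes.Census

open Polynomial Finset
open scoped BigOperators Polynomial

/-- **WINDOW ROOT LEMMA, distinct currency, four terms.**  If `f = Σ_{t<n} c_t X^{e_t}` has at least `n − 3` DISTINCT
positive roots, then for every window `{i,…,i+3}` (`i + 4 ≤ n`) the killed window 4-nomial has a positive root: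
`∃ x > 0, Σ_{t=i}^{i+3} c_t P_t x^{e_t} = 0`, `P_t = ∏_{u<n, u∉window} (e_t − e_u)` (iterated twisted Rolle: the `n − 4` kills
cost at most `n − 4` distinct roots). [folklore] -/
theorem exists_posRoot_window_four_card {n i : ℕ} (hi : i + 4 ≤ n) (e : ℕ → ℕ) (c : ℕ → ℝ)
    (hZ : n - 3 ≤ ((∑ t ∈ range n, C (c t) * X ^ (e t) : ℝ[X]).roots.toFinset.filter (fun x => 0 < x)).card) :
    ∃ x : ℝ, 0 < x ∧
      c i * (∏ u ∈ (range n).filter (fun u => u < i ∨ i + 4 ≤ u), ((e i : ℝ) - e u)) * x ^ e i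
      + c (i + 1) * (∏ u ∈ (range n).filter (fun u => u < i ∨ i + 4 ≤ u), ((e (i + 1) : ℝ) - e u)) * x ^ e (i + 1)
      + c (i + 2) * (∏ u ∈ (range n).filter (fun u => u < i ∨ i + 4 ≤ u), ((e (i + 2) : ℝ) - e u)) * x ^ e (i + 2)
      + c (i + 3) * (∏ u ∈ (range n).filter (fun u => u < i ∨ i + 4 ≤ u), ((e (i + 3) : ℝ) - e u)) * x ^ e (i + 3)
        = 0 := by
  classical
  -- iterated twisted Rolle over a kill set (distinct roots), proved locally
  have hkill : ∀ U : Finset ℕ,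
      ((∑ t ∈ range n, C (c t) * X ^ (e t) : ℝ[X]).roots.toFinset.filter (fun x => 0 < x)).card ≤
        ((∑ t ∈ range n, C (c t * ∏ u ∈ U, ((e t : ℝ) - e u)) * X ^ (e t) : ℝ[X]).roots.toFinset.filter
          (fun x => 0 < x)).card + U.card := by
    intro U
    induction U using Finset.induction_on with
    | empty => simp
    | insert u U hu ih =>
      rw [Finset.card_insert_of_notMem hu]
      have step := card_posRoots_le_card_posRoots_twist_succ
        (∑ t ∈ range n, C (c t * ∏ u' ∈ U, ((e t : ℝ) - e u')) * X ^ (e t) : ℝ[X]) (e u)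
      rw [twist_rsum] at step
      have hsum : (∑ t ∈ range n, C (c t * (∏ u' ∈ U, ((e t : ℝ) - e u')) * ((e t : ℝ) - e u)) * X ^ (e t) : ℝ[X])
          = ∑ t ∈ range n, C (c t * ∏ u' ∈ insert u U, ((e t : ℝ) - e u')) * X ^ (e t) := by
        refine Finset.sum_congr rfl fun t _ => ?_
        rw [Finset.prod_insert hu]
        ring_nf
      rw [hsum] at step
      omega
  set U := (range n).filter (fun u => u < i ∨ i + 4 ≤ u) with hU
  have hUcard : U.card = n - 4 := by
    have hsplit : U = range i ∪ Ico (i + 4) n := by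
      ext u
      simp only [hU, Finset.mem_filter, Finset.mem_range, Finset.mem_union, Finset.mem_Ico]
      omega
    rw [hsplit, Finset.card_union_of_disjoint, Finset.card_range, Nat.card_Ico]
    · omega
    · rw [Finset.disjoint_left]
      intro u hu1 hu2
      rw [Finset.mem_range] at hu1
      rw [Finset.mem_Ico] at hu2
      omega
  set Q : ℝ[X] := ∑ t ∈ range n, C (c t * ∏ u ∈ U, ((e t : ℝ) - e u)) * X ^ (e t) with hQ
  have hk := hkill U
  rw [hUcard] at hk
  have hQpos : 0 < (Q.roots.toFinset.filter (fun x => 0 < x)).card := by rw [hQ]; omega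
  obtain ⟨x, hxmem⟩ := Finset.card_pos.mp hQpos
  rw [Finset.mem_filter, Multiset.mem_toFinset] at hxmem
  obtain ⟨hxroot, hxpos⟩ := hxmem
  have hQ0 : Q ≠ 0 := by
    intro h0; rw [h0, roots_zero] at hxroot; simp at hxroot
  have hroot : Q.eval x = 0 := (mem_roots hQ0).mp hxroot
  refine ⟨x, hxpos, ?_⟩
  have heval : Q.eval x = ∑ t ∈ range n, c t * (∏ u ∈ U, ((e t : ℝ) - e u)) * x ^ (e t) := by
    rw [hQ, eval_finsetSum]
    refine Finset.sum_congr rfl fun t _ => ?_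
    rw [eval_mul, eval_C, eval_pow, eval_X]
  have hvanish : ∀ t ∈ range n, t ∉ Ico i (i + 4) → c t * (∏ u ∈ U, ((e t : ℝ) - e u)) * x ^ (e t) = 0 := by
    intro t ht hnot
    have htU : t ∈ U := by
      rw [hU, Finset.mem_filter]
      refine ⟨ht, ?_⟩
      rw [Finset.mem_Ico] at hnot
      omega
    rw [Finset.prod_eq_zero htU (sub_self _), mul_zero, zero_mul]
  have hsub : Ico i (i + 4) ⊆ range n := by
    intro t ht
    rw [Finset.mem_Ico] at ht
    exact Finset.mem_range.mpr (by omega)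
  have hwin : ∑ t ∈ Ico i (i + 4), c t * (∏ u ∈ U, ((e t : ℝ) - e u)) * x ^ (e t) = 0 := by
    rw [Finset.sum_subset hsub hvanish, ← heval]; exact hroot
  rw [show i + 4 = i + 1 + 1 + 1 + 1 by ring, Finset.sum_Ico_succ_top (by omega), Finset.sum_Ico_succ_top (by omega),
    Finset.sum_Ico_succ_top (by omega), Nat.Ico_succ_singleton, Finset.sum_singleton] at hwin
  exact hwin

/-- **FLANK BALANCE (low side of a repetition).**  Let `f = Σ_{t<n} c_t X^{e_t}` (`e` strictly increasing) have at
least `n − 3` DISTINCT positive roots, and let `c_i c_{i+1} < 0`, `c_{i+1} c_{i+2} < 0`,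
`c_{i+2} c_{i+3} > 0` (pattern `(−,+,−,−)`: isolated sign at `i+1`, repetition `(i+2, i+3)`).  Then for some
`x > 0`, with `w_t = ∏_{u<n, u∉{i,…,i+3}} |e_t − e_u|`:
`|c_{i+1}| w_{i+1} x^{e_{i+1}} = |c_i| w_i x^{e_i} + |c_{i+2}| w_{i+2} x^{e_{i+2}} + |c_{i+3}| w_{i+3} x^{e_{i+3}}`
— the isolated term balances the other three (distinct-currency twin of `flank_balance_low`). [folklore] -/
theorem flank_balance_low_card {n i : ℕ} (hi : i + 4 ≤ n) (e : ℕ → ℕ) (he : StrictMono e) (c : ℕ → ℝ)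
    (hZ : n - 3 ≤ ((∑ t ∈ range n, C (c t) * X ^ (e t) : ℝ[X]).roots.toFinset.filter (fun x => 0 < x)).card)
    (h1 : c i * c (i + 1) < 0) (h2 : c (i + 1) * c (i + 2) < 0) (h3 : 0 < c (i + 2) * c (i + 3)) :
    ∃ x : ℝ, 0 < x ∧
      |c (i + 1)| * (∏ u ∈ (range n).filter (fun u => u < i ∨ i + 4 ≤ u), |(e (i + 1) : ℝ) - e u|) * x ^ e (i + 1)
        = |c i| * (∏ u ∈ (range n).filter (fun u => u < i ∨ i + 4 ≤ u), |(e i : ℝ) - e u|) * x ^ e i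
          + |c (i + 2)| * (∏ u ∈ (range n).filter (fun u => u < i ∨ i + 4 ≤ u), |(e (i + 2) : ℝ) - e u|) * x ^ e (i + 2)
          + |c (i + 3)| * (∏ u ∈ (range n).filter (fun u => u < i ∨ i + 4 ≤ u), |(e (i + 3) : ℝ) - e u|) * x ^ e (i + 3) := by
  classical
  set U := (range n).filter (fun u => u < i ∨ i + 4 ≤ u) with hU
  set P : ℕ → ℝ := fun t => ∏ u ∈ U, ((e t : ℝ) - e u) with hP
  have hPabs : ∀ t, |P t| = ∏ u ∈ U, |(e t : ℝ) - e u| := fun t => by rw [hP]; exact Finset.abs_prod _ _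
  obtain ⟨x, hx, hroot⟩ := exists_posRoot_window_four_card hi e c hZ
  change c i * P i * x ^ e i + c (i + 1) * P (i + 1) * x ^ e (i + 1) + c (i + 2) * P (i + 2) * x ^ e (i + 2)
    + c (i + 3) * P (i + 3) * x ^ e (i + 3) = 0 at hroot
  have hPPgen : ∀ {s' t' : ℕ}, i ≤ s' → s' < i + 4 → i ≤ t' → t' < i + 4 → 0 < P s' * P t' := by
    intro s' t' hs hs' ht ht'
    simp only [hP]
    rw [← Finset.prod_mul_distrib]
    refine Finset.prod_pos fun u hu => ?_
    rw [hU, Finset.mem_filter] at hu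
    rcases hu.2 with hlt | hge
    · have h1 : (e u : ℝ) < e s' := by exact_mod_cast he (by omega)
      have h2 : (e u : ℝ) < e t' := by exact_mod_cast he (by omega)
      nlinarith
    · have h1 : (e s' : ℝ) < e u := by exact_mod_cast he (by omega)
      have h2 : (e t' : ℝ) < e u := by exact_mod_cast he (by omega)
      nlinarith
  have hPP02 : 0 < P i * P (i + 2) := hPPgen le_rfl (by omega) (by omega) (by omega)
  have hPP23 : 0 < P (i + 2) * P (i + 3) := hPPgen (by omega) (by omega) (by omega) (by omega)
  have hc02 : 0 < c i * c (i + 2) := by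
    have : 0 < (c i * c (i + 1)) * (c (i + 1) * c (i + 2)) := mul_pos_of_neg_of_neg h1 h2
    nlinarith [sq_nonneg (c (i + 1))]
  have hy : ∀ k, 0 < x ^ (e k) := fun k => pow_pos hx _
  have hs1 : 0 < (c i * P i * x ^ e i) * (c (i + 2) * P (i + 2) * x ^ e (i + 2)) := by
    have := mul_pos (mul_pos hc02 hPP02) (mul_pos (hy i) (hy (i + 2))); linarith
  have hs2 : 0 < (c (i + 2) * P (i + 2) * x ^ e (i + 2)) * (c (i + 3) * P (i + 3) * x ^ e (i + 3)) := by
    have := mul_pos (mul_pos h3 hPP23) (mul_pos (hy (i + 2)) (hy (i + 3))); linarith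
  have hiso : c (i + 1) * P (i + 1) * x ^ e (i + 1)
      = -(c i * P i * x ^ e i + c (i + 2) * P (i + 2) * x ^ e (i + 2) + c (i + 3) * P (i + 3) * x ^ e (i + 3)) := by
    linarith
  have habs := congrArg (fun r : ℝ => |r|) hiso
  simp only [abs_neg] at habs
  have habs3 : ∀ {u v w : ℝ}, 0 < u * v → 0 < v * w → |u + v + w| = |u| + |v| + |w| := by
    intro u v w huv hvw
    rcases lt_or_gt_of_ne (show v ≠ 0 from fun h => by rw [h, mul_zero] at huv; exact lt_irrefl 0 huv) with hv | hv
    · have hu : u < 0 := by nlinarith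
      have hw : w < 0 := by nlinarith
      rw [abs_of_neg hu, abs_of_neg hv, abs_of_neg hw, abs_of_neg (by linarith)]; ring
    · have hu : 0 < u := by nlinarith
      have hw : 0 < w := by nlinarith
      rw [abs_of_pos hu, abs_of_pos hv, abs_of_pos hw, abs_of_pos (by linarith)]
  rw [habs3 hs1 hs2] at habs
  refine ⟨x, hx, ?_⟩
  rw [← hPabs i, ← hPabs (i + 1), ← hPabs (i + 2), ← hPabs (i + 3)]
  simpa only [abs_mul, abs_of_pos (hy _)] using habs

/-- **FLANK ROW (low side of a repetition) — a new exact row.**  Under the hypotheses of `flank_balance_low_card`, with the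
REDUCED weights `w_t = ∏_{u<n, u∉{i,…,i+3}} |e_t − e_u|`, `a = e_{i+1} − e_i`, `b = e_{i+2} − e_{i+1}`:
`(a+b)^{a+b} · (|c_i| w_i)^b · (|c_{i+2}| w_{i+2})^a ≤ (|c_{i+1}| w_{i+1})^{a+b} · a^a · b^b`
— THEOREM N″'s row at `(i, i+1, i+2)` with each weight `W_t` divided by `|e_t − e_{i+3}|`, hence STRICTLY STRONGER
(`(e_{i+3} − e_i)^b (e_{i+3} − e_{i+2})^a ≤ (e_{i+3} − e_{i+1})^{a+b}` by concavity), and valid under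
`#Z₊^{distinct} ≥ n − 3`. [folklore] -/
theorem flank_row_low_card {n i : ℕ} (hi : i + 4 ≤ n) (e : ℕ → ℕ) (he : StrictMono e) (c : ℕ → ℝ)
    (hZ : n - 3 ≤ ((∑ t ∈ range n, C (c t) * X ^ (e t) : ℝ[X]).roots.toFinset.filter (fun x => 0 < x)).card)
    (h1 : c i * c (i + 1) < 0) (h2 : c (i + 1) * c (i + 2) < 0) (h3 : 0 < c (i + 2) * c (i + 3)) :
    (((e (i + 1) - e i : ℕ) : ℝ) + ((e (i + 2) - e (i + 1) : ℕ) : ℝ)) ^ (e (i + 1) - e i + (e (i + 2) - e (i + 1))) *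
        (|c i| * ∏ u ∈ (range n).filter (fun u => u < i ∨ i + 4 ≤ u), |(e i : ℝ) - e u|) ^ (e (i + 2) - e (i + 1)) *
        (|c (i + 2)| * ∏ u ∈ (range n).filter (fun u => u < i ∨ i + 4 ≤ u), |(e (i + 2) : ℝ) - e u|) ^ (e (i + 1) - e i)
      ≤ (|c (i + 1)| * ∏ u ∈ (range n).filter (fun u => u < i ∨ i + 4 ≤ u), |(e (i + 1) : ℝ) - e u|)
          ^ (e (i + 1) - e i + (e (i + 2) - e (i + 1))) *
        ((e (i + 1) - e i : ℕ) : ℝ) ^ (e (i + 1) - e i) * ((e (i + 2) - e (i + 1) : ℕ) : ℝ) ^ (e (i + 2) - e (i + 1)) := by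
  obtain ⟨x, hx, hbal⟩ := flank_balance_low_card hi e he c hZ h1 h2 h3
  set wA := ∏ u ∈ (range n).filter (fun u => u < i ∨ i + 4 ≤ u), |(e i : ℝ) - e u|
  set wB := ∏ u ∈ (range n).filter (fun u => u < i ∨ i + 4 ≤ u), |(e (i + 1) : ℝ) - e u|
  set wC := ∏ u ∈ (range n).filter (fun u => u < i ∨ i + 4 ≤ u), |(e (i + 2) : ℝ) - e u|
  set wD := ∏ u ∈ (range n).filter (fun u => u < i ∨ i + 4 ≤ u), |(e (i + 3) : ℝ) - e u|
  set a := e (i + 1) - e i with ha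
  set b := e (i + 2) - e (i + 1) with hb
  have hei1 : e i < e (i + 1) := he (by omega)
  have hei2 : e (i + 1) < e (i + 2) := he (by omega)
  have hy : ∀ k, 0 < x ^ (e k) := fun k => pow_pos hx _
  have hwD : 0 ≤ wD := Finset.prod_nonneg fun _ _ => abs_nonneg _
  have hAterm : |c i| * wA * x ^ e i = (|c i| * wA * x⁻¹ ^ a) * x ^ e (i + 1) := by
    rw [show e (i + 1) = e i + a by omega, pow_add, inv_pow]
    field_simp
  have hCterm : |c (i + 2)| * wC * x ^ e (i + 2) = (|c (i + 2)| * wC * x ^ b) * x ^ e (i + 1) := by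
    rw [show e (i + 2) = e (i + 1) + b by omega, pow_add]; ring
  have hD : 0 ≤ |c (i + 3)| * wD * x ^ e (i + 3) := by positivity
  have hkey : |c i| * wA * x⁻¹ ^ a + |c (i + 2)| * wC * x ^ b ≤ |c (i + 1)| * wB := by
    have hle : (|c i| * wA * x⁻¹ ^ a + |c (i + 2)| * wC * x ^ b) * x ^ e (i + 1)
        ≤ (|c (i + 1)| * wB) * x ^ e (i + 1) := by
      rw [add_mul, ← hAterm, ← hCterm, hbal]; linarith
    exact le_of_mul_le_mul_right hle (hy (i + 1))
  set MA := |c i| * wA with hMA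
  set MB := |c (i + 1)| * wB with hMB
  set MC := |c (i + 2)| * wC with hMC
  set PA := MA * x⁻¹ ^ a with hPA
  set QC := MC * x ^ b with hQC
  -- weighted AM–GM (the tree's `amgm_pow_nat`) from the two-term bound `hkey`
  have ha0 : 0 < a := by omega
  have hb0 : 0 < b := by omega
  have am := amgm_pow_nat ha0 hb0 (show 0 ≤ PA from by positivity) (show 0 ≤ QC from by positivity)
  have hone : (x⁻¹ ^ a) ^ b * (x ^ b) ^ a = 1 := by
    rw [← pow_mul, ← pow_mul, mul_comm b a, ← mul_pow, inv_mul_cancel₀ hx.ne', one_pow]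
  have hprod : PA ^ b * QC ^ a = MA ^ b * MC ^ a := by
    simp only [hPA, hQC]
    calc (MA * x⁻¹ ^ a) ^ b * (MC * x ^ b) ^ a = MA ^ b * MC ^ a * ((x⁻¹ ^ a) ^ b * (x ^ b) ^ a) := by ring
      _ = MA ^ b * MC ^ a := by rw [hone, mul_one]
  have hmono : (PA + QC) ^ (a + b) ≤ MB ^ (a + b) := pow_le_pow_left₀ (by positivity) hkey _
  calc ((a : ℝ) + b) ^ (a + b) * MA ^ b * MC ^ a
      = ((a : ℝ) + b) ^ (a + b) * PA ^ b * QC ^ a := by rw [mul_assoc, ← hprod, ← mul_assoc]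
    _ ≤ (PA + QC) ^ (a + b) * (a : ℝ) ^ a * (b : ℝ) ^ b := am
    _ ≤ MB ^ (a + b) * (a : ℝ) ^ a * (b : ℝ) ^ b := by gcongr

/-- **FLANK BALANCE (high side of a repetition).**  Mirror of `flank_balance_low_card`: pattern `(+,+,−,+)`,
`c_i c_{i+1} > 0`, `c_{i+1} c_{i+2} < 0`, `c_{i+2} c_{i+3} < 0` (repetition `(i, i+1)`, isolated sign at `i+2`):
`|c_{i+2}| w_{i+2} x^{e_{i+2}} = |c_i| w_i x^{e_i} + |c_{i+1}| w_{i+1} x^{e_{i+1}} + |c_{i+3}| w_{i+3} x^{e_{i+3}}` for some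
`x > 0`. [folklore] -/
theorem flank_balance_high_card {n i : ℕ} (hi : i + 4 ≤ n) (e : ℕ → ℕ) (he : StrictMono e) (c : ℕ → ℝ)
    (hZ : n - 3 ≤ ((∑ t ∈ range n, C (c t) * X ^ (e t) : ℝ[X]).roots.toFinset.filter (fun x => 0 < x)).card)
    (h1 : 0 < c i * c (i + 1)) (h2 : c (i + 1) * c (i + 2) < 0) (h3 : c (i + 2) * c (i + 3) < 0) :
    ∃ x : ℝ, 0 < x ∧
      |c (i + 2)| * (∏ u ∈ (range n).filter (fun u => u < i ∨ i + 4 ≤ u), |(e (i + 2) : ℝ) - e u|) * x ^ e (i + 2)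
        = |c i| * (∏ u ∈ (range n).filter (fun u => u < i ∨ i + 4 ≤ u), |(e i : ℝ) - e u|) * x ^ e i
          + |c (i + 1)| * (∏ u ∈ (range n).filter (fun u => u < i ∨ i + 4 ≤ u), |(e (i + 1) : ℝ) - e u|) * x ^ e (i + 1)
          + |c (i + 3)| * (∏ u ∈ (range n).filter (fun u => u < i ∨ i + 4 ≤ u), |(e (i + 3) : ℝ) - e u|) * x ^ e (i + 3) := by
  classical
  set U := (range n).filter (fun u => u < i ∨ i + 4 ≤ u) with hU
  set P : ℕ → ℝ := fun t => ∏ u ∈ U, ((e t : ℝ) - e u) with hP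
  have hPabs : ∀ t, |P t| = ∏ u ∈ U, |(e t : ℝ) - e u| := fun t => by rw [hP]; exact Finset.abs_prod _ _
  obtain ⟨x, hx, hroot⟩ := exists_posRoot_window_four_card hi e c hZ
  change c i * P i * x ^ e i + c (i + 1) * P (i + 1) * x ^ e (i + 1) + c (i + 2) * P (i + 2) * x ^ e (i + 2)
    + c (i + 3) * P (i + 3) * x ^ e (i + 3) = 0 at hroot
  have hPPgen : ∀ {s' t' : ℕ}, i ≤ s' → s' < i + 4 → i ≤ t' → t' < i + 4 → 0 < P s' * P t' := by
    intro s' t' hs hs' ht ht'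
    simp only [hP]
    rw [← Finset.prod_mul_distrib]
    refine Finset.prod_pos fun u hu => ?_
    rw [hU, Finset.mem_filter] at hu
    rcases hu.2 with hlt | hge
    · have h1 : (e u : ℝ) < e s' := by exact_mod_cast he (by omega)
      have h2 : (e u : ℝ) < e t' := by exact_mod_cast he (by omega)
      nlinarith
    · have h1 : (e s' : ℝ) < e u := by exact_mod_cast he (by omega)
      have h2 : (e t' : ℝ) < e u := by exact_mod_cast he (by omega)
      nlinarith
  have hPP01 : 0 < P i * P (i + 1) := hPPgen le_rfl (by omega) (by omega) (by omega)
  have hPP13 : 0 < P (i + 1) * P (i + 3) := hPPgen (by omega) (by omega) (by omega) (by omega)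
  have hc13 : 0 < c (i + 1) * c (i + 3) := by
    have : 0 < (c (i + 1) * c (i + 2)) * (c (i + 2) * c (i + 3)) := mul_pos_of_neg_of_neg h2 h3
    nlinarith [sq_nonneg (c (i + 2))]
  have hy : ∀ k, 0 < x ^ (e k) := fun k => pow_pos hx _
  have hs1 : 0 < (c i * P i * x ^ e i) * (c (i + 1) * P (i + 1) * x ^ e (i + 1)) := by
    have := mul_pos (mul_pos h1 hPP01) (mul_pos (hy i) (hy (i + 1))); linarith
  have hs2 : 0 < (c (i + 1) * P (i + 1) * x ^ e (i + 1)) * (c (i + 3) * P (i + 3) * x ^ e (i + 3)) := by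
    have := mul_pos (mul_pos hc13 hPP13) (mul_pos (hy (i + 1)) (hy (i + 3))); linarith
  have hiso : c (i + 2) * P (i + 2) * x ^ e (i + 2)
      = -(c i * P i * x ^ e i + c (i + 1) * P (i + 1) * x ^ e (i + 1) + c (i + 3) * P (i + 3) * x ^ e (i + 3)) := by
    linarith
  have habs := congrArg (fun r : ℝ => |r|) hiso
  simp only [abs_neg] at habs
  have habs3 : ∀ {u v w : ℝ}, 0 < u * v → 0 < v * w → |u + v + w| = |u| + |v| + |w| := by
    intro u v w huv hvw
    rcases lt_or_gt_of_ne (show v ≠ 0 from fun h => by rw [h, mul_zero] at huv; exact lt_irrefl 0 huv) with hv | hv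
    · have hu : u < 0 := by nlinarith
      have hw : w < 0 := by nlinarith
      rw [abs_of_neg hu, abs_of_neg hv, abs_of_neg hw, abs_of_neg (by linarith)]; ring
    · have hu : 0 < u := by nlinarith
      have hw : 0 < w := by nlinarith
      rw [abs_of_pos hu, abs_of_pos hv, abs_of_pos hw, abs_of_pos (by linarith)]
  rw [habs3 hs1 hs2] at habs
  refine ⟨x, hx, ?_⟩
  rw [← hPabs i, ← hPabs (i + 1), ← hPabs (i + 2), ← hPabs (i + 3)]
  simpa only [abs_mul, abs_of_pos (hy _)] using habs

/-- **FLANK ROW (high side of a repetition).**  Under the hypotheses of `flank_balance_high_card`, with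
`w_t = ∏_{u<n, u∉{i,…,i+3}} |e_t − e_u|`, `a = e_{i+2} − e_{i+1}`, `b = e_{i+3} − e_{i+2}`:
`(a+b)^{a+b} · (|c_{i+1}| w_{i+1})^b · (|c_{i+3}| w_{i+3})^a ≤ (|c_{i+2}| w_{i+2})^{a+b} · a^a · b^b`
— THEOREM N″'s row at `(i+1, i+2, i+3)` with each weight divided by `|e_t − e_i|`. [folklore] -/
theorem flank_row_high_card {n i : ℕ} (hi : i + 4 ≤ n) (e : ℕ → ℕ) (he : StrictMono e) (c : ℕ → ℝ)
    (hZ : n - 3 ≤ ((∑ t ∈ range n, C (c t) * X ^ (e t) : ℝ[X]).roots.toFinset.filter (fun x => 0 < x)).card)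
    (h1 : 0 < c i * c (i + 1)) (h2 : c (i + 1) * c (i + 2) < 0) (h3 : c (i + 2) * c (i + 3) < 0) :
    (((e (i + 2) - e (i + 1) : ℕ) : ℝ) + ((e (i + 3) - e (i + 2) : ℕ) : ℝ)) ^ (e (i + 2) - e (i + 1) + (e (i + 3) - e (i + 2))) *
        (|c (i + 1)| * ∏ u ∈ (range n).filter (fun u => u < i ∨ i + 4 ≤ u), |(e (i + 1) : ℝ) - e u|) ^ (e (i + 3) - e (i + 2)) *
        (|c (i + 3)| * ∏ u ∈ (range n).filter (fun u => u < i ∨ i + 4 ≤ u), |(e (i + 3) : ℝ) - e u|) ^ (e (i + 2) - e (i + 1))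
      ≤ (|c (i + 2)| * ∏ u ∈ (range n).filter (fun u => u < i ∨ i + 4 ≤ u), |(e (i + 2) : ℝ) - e u|)
          ^ (e (i + 2) - e (i + 1) + (e (i + 3) - e (i + 2))) *
        ((e (i + 2) - e (i + 1) : ℕ) : ℝ) ^ (e (i + 2) - e (i + 1)) * ((e (i + 3) - e (i + 2) : ℕ) : ℝ) ^ (e (i + 3) - e (i + 2)) := by
  obtain ⟨x, hx, hbal⟩ := flank_balance_high_card hi e he c hZ h1 h2 h3
  set wA := ∏ u ∈ (range n).filter (fun u => u < i ∨ i + 4 ≤ u), |(e i : ℝ) - e u|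
  set wB := ∏ u ∈ (range n).filter (fun u => u < i ∨ i + 4 ≤ u), |(e (i + 1) : ℝ) - e u|
  set wC := ∏ u ∈ (range n).filter (fun u => u < i ∨ i + 4 ≤ u), |(e (i + 2) : ℝ) - e u|
  set wD := ∏ u ∈ (range n).filter (fun u => u < i ∨ i + 4 ≤ u), |(e (i + 3) : ℝ) - e u|
  set a := e (i + 2) - e (i + 1) with ha
  set b := e (i + 3) - e (i + 2) with hb
  have hei1 : e (i + 1) < e (i + 2) := he (by omega)
  have hei2 : e (i + 2) < e (i + 3) := he (by omega)
  have hy : ∀ k, 0 < x ^ (e k) := fun k => pow_pos hx _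
  have hwD : 0 ≤ wD := Finset.prod_nonneg fun _ _ => abs_nonneg _
  have hBterm : |c (i + 1)| * wB * x ^ e (i + 1) = (|c (i + 1)| * wB * x⁻¹ ^ a) * x ^ e (i + 2) := by
    rw [show e (i + 2) = e (i + 1) + a by omega, pow_add, inv_pow]
    field_simp
  have hDterm : |c (i + 3)| * wD * x ^ e (i + 3) = (|c (i + 3)| * wD * x ^ b) * x ^ e (i + 2) := by
    rw [show e (i + 3) = e (i + 2) + b by omega, pow_add]; ring
  have hA : 0 ≤ |c i| * wA * x ^ e i := by positivity
  have hkey : |c (i + 1)| * wB * x⁻¹ ^ a + |c (i + 3)| * wD * x ^ b ≤ |c (i + 2)| * wC := by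
    have hle : (|c (i + 1)| * wB * x⁻¹ ^ a + |c (i + 3)| * wD * x ^ b) * x ^ e (i + 2)
        ≤ (|c (i + 2)| * wC) * x ^ e (i + 2) := by
      rw [add_mul, ← hBterm, ← hDterm, hbal]; linarith
    exact le_of_mul_le_mul_right hle (hy (i + 2))
  set MA := |c (i + 1)| * wB with hMA
  set MB := |c (i + 2)| * wC with hMB
  set MC := |c (i + 3)| * wD with hMC
  set PA := MA * x⁻¹ ^ a with hPA
  set QC := MC * x ^ b with hQC
  -- weighted AM–GM (the tree's `amgm_pow_nat`) from the two-term bound `hkey`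
  have ha0 : 0 < a := by omega
  have hb0 : 0 < b := by omega
  have am := amgm_pow_nat ha0 hb0 (show 0 ≤ PA from by positivity) (show 0 ≤ QC from by positivity)
  have hone : (x⁻¹ ^ a) ^ b * (x ^ b) ^ a = 1 := by
    rw [← pow_mul, ← pow_mul, mul_comm b a, ← mul_pow, inv_mul_cancel₀ hx.ne', one_pow]
  have hprod : PA ^ b * QC ^ a = MA ^ b * MC ^ a := by
    simp only [hPA, hQC]
    calc (MA * x⁻¹ ^ a) ^ b * (MC * x ^ b) ^ a = MA ^ b * MC ^ a * ((x⁻¹ ^ a) ^ b * (x ^ b) ^ a) := by ring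
      _ = MA ^ b * MC ^ a := by rw [hone, mul_one]
  have hmono : (PA + QC) ^ (a + b) ≤ MB ^ (a + b) := pow_le_pow_left₀ (by positivity) hkey _
  calc ((a : ℝ) + b) ^ (a + b) * MA ^ b * MC ^ a
      = ((a : ℝ) + b) ^ (a + b) * PA ^ b * QC ^ a := by rw [mul_assoc, ← hprod, ← mul_assoc]
    _ ≤ (PA + QC) ^ (a + b) * (a : ℝ) ^ a * (b : ℝ) ^ b := am
    _ ≤ MB ^ (a + b) * (a : ℝ) ^ a * (b : ℝ) ^ b := by gcongr

end Summit.ValiantsHypothesis.ValiantsHypothesis.Theorems.LacunarySymmetroidMatrixDescartes.Census
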